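import Literature.Analysis.FluidPDE.PassiveScalarForcedRenormalized
import Literature.Analysis.FluidPDE.PassiveScalarEnergyL1Sobolev
import HarnessLib

/-!
# Energy inequality for steadily SOURCED passive scalars with `L¹ₜ Ḣ¹ₓ` drift

Analysis/FluidPDE proof-support file (everything proved). For `κ > 0`, `θ₀ ∈ L²(T^d)`, a smooth
steady source `f` and a weak solution `θ ∈ L^∞(0,T; L²)` of `∂ₜθ + u·∇θ = κΔθ + f` on
`T^d × [0,T)` (`Torus.IsWeakScalarTransportForcedOn`) whose drift has
`∫₀ᵀ ‖∇u(t)‖_{L²} dt < ∞`, the energy inequality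

  `2κ ∫₀ᵀ ‖∇θ(t)‖²_{L²} dt ≤ ‖θ₀‖²_{L²} + 2 ∫₀ᵀ ∫ θ f`

(`energy_ineq_of_lintegral_eGradNormSq_rpow_lt_top`, spectral gradient norm, `ℝ≥0∞` form plus
nonnegativity of the real right-hand side). This is the sourced version of
`PassiveScalarEnergyL1Sobolev` and is proved by the same DiPerna–Lions renormalisation
(DiPerna–Lions 1989, §II.3, Thm. II.3): with `A_ε = θ ⋆ k_ε`, `β = renorm M`,
`∫ β(A_ε(t)) = ∫ β(θ₀ ⋆ k_ε) + ∫₀ᵗ∫ β'(A_ε)(G_ε + f ⋆ k_ε)` (`PassiveScalarForcedRenormalized`),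
`∫ β'(A_ε) G_ε = ∫ β'(A_ε) r_ε - 2κ‖∇(S_M ∘ A_ε)‖²` slice-wise, the commutator `r_ε → 0` in
`L¹_{t,x}` against the bounded `β'(A_ε)`, and the source term
`∫₀ᵗ∫ β'(A_ε)(f ⋆ k_ε) → ∫₀ᵗ∫ β'_M(θ) f → 2∫₀ᵗ∫ θ f` (`ε → 0`, then `M → ∞`); two
lower-semicontinuity/Fatou passages at a.e. `t` and a monotone passage `t → T` conclude.
It is the energy input `(H1)` of the age-decoupling argument for steadily sourced scalars
(`FluidPDE/AgeDecouplingInequality`).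

## References

* R. J. DiPerna, P.-L. Lions, Invent. Math. 98 (1989), §II.3, Thm. II.3. [`DiPernaLions1989`]
* T. D. Drivas, T. M. Elgindi, G. Iyer, I.-J. Jeong, ARMA 243 (2022), (1.1)–(1.3). [`DEIJ2022`]
-/

noncomputable section

open MeasureTheory TopologicalSpace Set Function Filter Topology Metric ContinuousLinearMap
  UnitAddTorus
open scoped ENNReal NNReal Convolution ContDiff InnerProductSpace

namespace Literature.Analysis.FluidPDE

namespace Torus

variable {d : Type*} [Fintype d]

/-! ## Elementary lemmas -/

/-- `renormDeriv M y = 2y` once `|y| ≤ M` (the cut-off is `1` on `[-M, M]`). [folklore] -/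
theorem renormDeriv_eq_two_mul {M y : ℝ} (hy : |y| ≤ M) : Calculus.renormDeriv M y = 2 * y := by
  rw [Calculus.renormDeriv]
  have h : ∀ r ∈ Set.uIcc 0 y, 2 * (Calculus.truncCutoff M) r ^ 2 = 2 := by
    intro r hr
    have hr' : |r| ≤ M := by
      rcases le_total 0 y with h0 | h0
      · rw [uIcc_of_le h0] at hr
        rw [abs_of_nonneg hr.1]
        exact hr.2.trans ((le_abs_self y).trans hy)
      · rw [uIcc_of_ge h0] at hr
        rw [abs_of_nonpos hr.2]
        have : -y ≤ M := (neg_le_abs y).trans hy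
        linarith [hr.1]
    rw [Calculus.truncCutoff_eq_one hr']
    norm_num
  rw [intervalIntegral.integral_congr h, intervalIntegral.integral_const, smul_eq_mul, sub_zero, mul_comm]

/-- `renormDeriv M` is `2`-Lipschitz (`0 ≤ (renormDeriv M)' ≤ 2`). [folklore] -/
theorem abs_renormDeriv_sub_le (M a b : ℝ) :
    |Calculus.renormDeriv M a - Calculus.renormDeriv M b| ≤ 2 * |a - b| := by
  have hd : ∀ y, ‖deriv (Calculus.renormDeriv M) y‖ ≤ 2 := fun y => by
    rw [Calculus.deriv_renormDeriv, Real.norm_eq_abs, abs_of_nonneg (by positivity)]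
    have h1 := Calculus.abs_truncCutoff_le_one M y
    rw [abs_le] at h1
    nlinarith [(Calculus.truncCutoff M).nonneg (x := y)]
  have hdiff : Differentiable ℝ (Calculus.renormDeriv M) := (Calculus.contDiff_renormDeriv M).differentiable (by simp)
  have := Convex.norm_image_sub_le_of_norm_deriv_le (s := Set.univ) (fun x _ => hdiff.differentiableAt)
    (fun y _ => hd y) convex_univ (mem_univ b) (mem_univ a)
  simpa [Real.norm_eq_abs] using this

/-- Good times accumulating at `T⁻`, monotonically: if a property holds for a.e. `t ∈ (0,T)`,
`T > 0`, there is a nondecreasing sequence of good times `tₙ ∈ (0,T)` with `tₙ → T`. [folklore] -/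
theorem exists_monotone_tendsto_of_ae {T : ℝ} (hT : 0 < T) {P : ℝ → Prop}
    (h : ∀ᵐ t ∂((volume : Measure ℝ).restrict (Ioo 0 T)), P t) :
    ∃ t : ℕ → ℝ, Monotone t ∧ (∀ n, t n ∈ Ioo 0 T ∧ P (t n)) ∧ Tendsto t atTop (𝓝 T) := by
  have hgood : ∀ n : ℕ, ∃ t ∈ Ioo (max 0 (T - 1 / ((n : ℝ) + 1))) T, P t := by
    intro n
    set a : ℝ := max 0 (T - 1 / ((n : ℝ) + 1)) with ha
    have haT : a < T := max_lt hT (by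
      have : (0 : ℝ) < 1 / ((n : ℝ) + 1) := by positivity
      linarith)
    have hsub : Ioo a T ⊆ Ioo 0 T := Ioo_subset_Ioo_left (le_max_left _ _)
    have h' : ∀ᵐ t ∂((volume : Measure ℝ).restrict (Ioo a T)), t ∈ Ioo a T ∧ P t :=
      (ae_restrict_mem measurableSet_Ioo).and (ae_restrict_of_ae_restrict_of_subset hsub h)
    haveI hne : (ae ((volume : Measure ℝ).restrict (Ioo a T))).NeBot := by
      rw [ae_neBot, Ne, Measure.restrict_eq_zero, Real.volume_Ioo, ENNReal.ofReal_eq_zero, not_le]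
      linarith
    obtain ⟨t, ht⟩ := h'.exists
    exact ⟨t, ht.1, ht.2⟩
  choose t ht hP using hgood
  have ht0T : ∀ n, t n ∈ Ioo 0 T := fun n => ⟨(le_max_left _ _).trans_lt (ht n).1, (ht n).2⟩
  -- running maximum
  set s : ℕ → ℝ := fun n => (Finset.range (n + 1)).sup' (Finset.nonempty_range_iff.2 (Nat.succ_ne_zero _)) t with hs
  have hs_mem : ∀ n, ∃ i, i ≤ n ∧ s n = t i := by
    intro n
    obtain ⟨i, hi, he⟩ := Finset.exists_mem_eq_sup' ((Finset.nonempty_range_iff.2 (Nat.succ_ne_zero n))) t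
    exact ⟨i, Nat.lt_succ_iff.1 (Finset.mem_range.1 hi), he⟩
  have hts : ∀ n, t n ≤ s n := fun n => Finset.le_sup' t (Finset.mem_range.2 (Nat.lt_succ_self n))
  refine ⟨s, ?_, fun n => ?_, ?_⟩
  · intro m n hmn
    exact Finset.sup'_mono t (Finset.range_mono (Nat.succ_le_succ hmn)) _
  · obtain ⟨i, -, he⟩ := hs_mem n
    rw [he]
    exact ⟨ht0T i, hP i⟩
  · have hlow : Tendsto (fun n : ℕ => T - 1 / ((n : ℝ) + 1)) atTop (𝓝 T) := by
      have := (tendsto_one_div_add_atTop_nhds_zero_nat (𝕜 := ℝ)).const_sub T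
      simpa using this
    refine tendsto_of_tendsto_of_tendsto_of_le_of_le hlow tendsto_const_nhds (fun n => ?_) fun n => ?_
    · exact ((le_max_right _ _).trans_lt (ht n).1).le.trans (hts n)
    · obtain ⟨i, -, he⟩ := hs_mem n
      rw [he]
      exact (ht0T i).2.le

/-- From a.e. `t` to `T` for a set `ℝ≥0∞` integral bounded by a continuous real budget: if
`∫⁻_{(0,t)} g ≤ ofReal (F t)` for a.e. `t ∈ (0,T)` and `F` is continuous on `[0,T]`, then
`∫⁻_{(0,T)} g ≤ ofReal (F T)`. [folklore] -/
theorem setLIntegral_Ioo_le_ofReal_of_ae {g : ℝ → ℝ≥0∞} {F : ℝ → ℝ} {T : ℝ} (hT : 0 < T)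
    (hF : ContinuousOn F (Icc 0 T))
    (h : ∀ᵐ t ∂((volume : Measure ℝ).restrict (Ioo 0 T)), ∫⁻ s in Ioo 0 t, g s ≤ ENNReal.ofReal (F t)) :
    ∫⁻ s in Ioo 0 T, g s ≤ ENNReal.ofReal (F T) := by
  obtain ⟨t, htm, ht, htT⟩ := exists_monotone_tendsto_of_ae hT h
  have hdir : Directed (· ⊆ ·) fun n => Ioo 0 (t n) := by
    intro i j
    rcases le_total (t i) (t j) with hij | hij
    · exact ⟨j, Ioo_subset_Ioo_right hij, subset_rfl⟩
    · exact ⟨i, subset_rfl, Ioo_subset_Ioo_right hij⟩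
  have hU : (⋃ n, Ioo 0 (t n)) = Ioo 0 T := by
    ext x
    simp only [mem_iUnion, mem_Ioo]
    constructor
    · rintro ⟨n, hx0, hxn⟩
      exact ⟨hx0, hxn.trans (ht n).1.2⟩
    · rintro ⟨hx0, hxT⟩
      obtain ⟨n, hn⟩ := (htT.eventually (lt_mem_nhds hxT)).exists
      exact ⟨n, hx0, hn⟩
  have hX : Tendsto (fun n => ∫⁻ s in Ioo 0 (t n), g s) atTop (𝓝 (∫⁻ s in Ioo 0 T, g s)) := by
    rw [← hU, setLIntegral_iUnion_of_directed g hdir]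
    exact tendsto_atTop_iSup fun m n hmn => lintegral_mono_set (Ioo_subset_Ioo_right (htm hmn))
  have hY : Tendsto (fun n => ENNReal.ofReal (F (t n))) atTop (𝓝 (ENNReal.ofReal (F T))) := by
    refine ENNReal.tendsto_ofReal ?_
    have hc := hF T (right_mem_Icc.2 hT.le)
    exact hc.tendsto.comp (tendsto_nhdsWithin_of_tendsto_nhds_of_eventually_within t htT
      (Eventually.of_forall fun n => Ioo_subset_Icc_self (ht n).1))
  exact le_of_tendsto_of_tendsto' hX hY fun n => (ht n).2

namespace IsWeakScalarTransportForcedOn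

variable {T κ : ℝ} {u : ℝ → UnitAddTorus d → EuclideanSpace ℝ d} {f : UnitAddTorus d → ℝ}
  {θ₀ : UnitAddTorus d → ℝ} {θ : ℝ → UnitAddTorus d → ℝ}

/-- **Energy inequality for weak solutions of the steadily sourced passive scalar equation with
`L¹ₜ Ḣ¹ₓ` drift** (DiPerna–Lions 1989, §II.3 renormalisation, with a smooth steady source):
for `κ > 0`, `θ₀ ∈ L²`, a weak solution `θ ∈ L^∞(0,T;L²)` of `∂ₜθ + u·∇θ = κΔθ + f` whose
drift has `∫₀ᵀ ‖∇u(t)‖_{L²} dt < ∞`,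
`2 · eScalarDissipation κ θ 0 T ≤ ofReal (∫ θ₀² + 2 ∫₀ᵀ ∫ θ f)` and the real budget
`∫ θ₀² + 2 ∫₀ᵀ ∫ θ f` is nonnegative. [cite: DiPernaLions1989, §II.3 Thm. II.3] -/
theorem energy_ineq_of_lintegral_eGradNormSq_rpow_lt_top (hκ : 0 < κ)
    (h : IsWeakScalarTransportForcedOn T κ u (fun _ => f) θ₀ θ)
    (hθ₀ : MemLp θ₀ 2 volume) (hf : FunctionSpaces.Torus.IsSmooth f)
    (hG : ∫⁻ t in Ioo 0 T, FunctionSpaces.Torus.eGradNormSq (u t) ^ (1 / 2 : ℝ) < ⊤) :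
    2 * eScalarDissipation κ θ 0 T ≤
        ENNReal.ofReal ((∫ x, θ₀ x ^ 2) + 2 * ∫ t in Ioo 0 T, ∫ x, θ t x * f x) ∧
      0 ≤ (∫ x, θ₀ x ^ 2) + 2 * ∫ t in Ioo 0 T, ∫ x, θ t x * f x := by
  classical
  haveI : (volume : Measure (UnitAddTorus d)).IsNegInvariant := Pi.isNegInvariant_volume
  have hθ₀sq : 0 ≤ ∫ x, θ₀ x ^ 2 := integral_nonneg fun x => sq_nonneg _
  -- trivial case `T ≤ 0`
  rcases le_or_gt T 0 with hT | hT
  · have h0 : eScalarDissipation κ θ 0 T = 0 := by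
      rw [eScalarDissipation, Ioo_eq_empty_of_le hT, Measure.restrict_empty, lintegral_zero_measure,
        mul_zero]
    have h1 : ∫ t in Ioo 0 T, ∫ x, θ t x * f x = 0 := by
      rw [Ioo_eq_empty_of_le hT, Measure.restrict_empty, integral_zero_measure]
    rw [h0, mul_zero, h1, mul_zero, add_zero]
    exact ⟨zero_le, hθ₀sq⟩
  set μT : Measure ℝ := (volume : Measure ℝ).restrict (Ioo 0 T) with hμT
  haveI : IsFiniteMeasure μT := by rw [hμT]; infer_instance
  -- radii and kernels
  obtain ⟨hε, hε', hε0⟩ := molRadius_spec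
  set ε : ℕ → ℝ := fun n => 1 / (4 * ((n : ℝ) + 1)) with hε_def
  set kk : ℕ → UnitAddTorus d → ℝ := fun n => FunctionSpaces.Torus.kernel (d := d) (ε n) with hkk
  have hkS : ∀ n, FunctionSpaces.Torus.IsSmooth (kk n) := fun n => FunctionSpaces.Torus.isSmooth_kernel (hε n) (hε' n)
  have hk1 : ∀ n, ∫⁻ y, ‖kk n y‖ₑ = 1 := fun n => FunctionSpaces.Torus.lintegral_enorm_kernel (hε n) (hε' n)
  have hk0 : ∀ n y, 0 ≤ kk n y := fun n y => FunctionSpaces.Torus.kernel_nonneg (hε n).le y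
  have hkint : ∀ n, ∫ y, kk n y = 1 := fun n => FunctionSpaces.Torus.integral_kernel (hε n) (hε' n)
  -- the source: sup bound, mollification and its uniform convergence
  obtain ⟨Cf, hCf⟩ := FunctionSpaces.Torus.exists_forall_norm_le_of_continuous hf.continuous
  have hCf0 : 0 ≤ Cf := (norm_nonneg _).trans (hCf 0)
  set Sn : ℕ → UnitAddTorus d → ℝ := fun n x => ∫ y, f y * kk n (x - y) with hSn_def
  have hSn_conv : ∀ n, Sn n = f ⋆ kk n := fun n => by
    funext x; simp only [hSn_def, convolution_lsmul, smul_eq_mul]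
  have hSn_cont : ∀ n, Continuous (Sn n) := fun n => by
    rw [hSn_conv n]; exact FunctionSpaces.Torus.continuous_convolution hf.continuous.integrable_unitAddTorus (hkS n).continuous
  have hSn_le : ∀ n x, |Sn n x| ≤ Cf := by
    intro n x
    have hkc : Continuous fun y => kk n (x - y) := (hkS n).continuous.comp (continuous_const.sub continuous_id)
    calc |Sn n x| ≤ ∫ y, |f y * kk n (x - y)| := abs_integral_le_integral_abs
      _ ≤ ∫ y, Cf * kk n (x - y) := by
          refine integral_mono ((hf.continuous.mul hkc).abs.integrable_unitAddTorus)
            ((continuous_const.mul hkc).integrable_unitAddTorus) fun y => ?_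
          dsimp only
          rw [abs_mul, abs_of_nonneg (hk0 n _)]
          exact mul_le_mul_of_nonneg_right (by simpa [Real.norm_eq_abs] using hCf y) (hk0 n _)
      _ = Cf := by
          rw [MeasureTheory.integral_const_mul, integral_sub_left_eq_self (fun z => kk n z) volume x, hkint n, mul_one]
  have hSn_unif : ∀ η : ℝ, 0 < η → ∀ᶠ n in atTop, ∀ x, |Sn n x - f x| ≤ η := by
    intro η hη
    obtain ⟨δ, hδ, hδP⟩ := FunctionSpaces.Torus.exists_forall_dist_convolution_le hf.continuous hη
    filter_upwards [(tendsto_order.1 hε0).2 δ hδ] with n hn x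
    have hsupp : support (kk n) ⊆ ball 0 δ :=
      (FunctionSpaces.Torus.support_kernel_subset (hε n)).trans (ball_subset_ball hn.le)
    have := hδP hsupp (hk0 n) (hkint n) x
    rwa [← FunctionSpaces.Torus.convolution_comm_real, ← hSn_conv n, Real.dist_eq] at this
  -- bounds on the slices
  obtain ⟨C₁, hC₁⟩ := h.exists_eLpNorm_le
  have hθ₀i : Integrable θ₀ volume := hθ₀.integrable one_le_two
  have hGm : AEMeasurable (fun t => FunctionSpaces.Torus.eGradNormSq (u t)) μT :=
    aemeasurable_eGradNormSq_slice h.aestronglyMeasurable_uncurry_velocity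
  have hgood : ∀ᵐ s ∂μT, (Integrable (θ s) volume ∧ AEStronglyMeasurable (u s) volume ∧
      Integrable (fun y => ‖u s y‖ * θ s y) volume) ∧ FunctionSpaces.Torus.IsWeaklyDivFree (u s) ∧
      MemLp (θ s) 2 volume ∧ eLpNorm (θ s) 2 volume ≤ C₁ ∧ Integrable (u s) volume ∧ MemLp (u s) 2 volume ∧
      FunctionSpaces.Torus.eGradNormSq (u s) < ⊤ := by
    have hGfin : ∀ᵐ s ∂μT, FunctionSpaces.Torus.eGradNormSq (u s) < ⊤ := by
      have h1 : ∀ᵐ s ∂μT, FunctionSpaces.Torus.eGradNormSq (u s) ^ (1 / 2 : ℝ) < ⊤ :=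
        ae_lt_top' (hGm.pow_const _) hG.ne
      filter_upwards [h1] with s hs
      by_contra htop
      rw [not_lt, top_le_iff] at htop
      rw [htop, ENNReal.top_rpow_of_pos (by norm_num)] at hs
      exact lt_irrefl _ hs
    filter_upwards [h.ae_slice_integrable₁, h.ae_isWeaklyDivFree, h.ae_memLp_two, hC₁, h.ae_integrable_velocity,
      h.ae_memLp_two_velocity, hGfin] with s h1 h2 h3 h4 h5 h6 h7
    exact ⟨⟨h1.1, h1.2.1, h1.2.2.1⟩, h2, h3, h4, h5, h6, h7⟩
  have hconv : ∀ (δ : UnitAddTorus d → ℝ) (n : ℕ) (x : UnitAddTorus d), (δ ⋆ kk n) x = ∫ y, δ y * kk n (x - y) :=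
    fun δ n x => by simp only [convolution_lsmul, smul_eq_mul]
  -- ### the commutator size `ρ n s = ∫ |r_n(s,x)| dx`
  set ρ : ℕ → ℝ → ℝ≥0∞ := fun n s => ∫⁻ x, ‖∫ y, θ s y * ⟪u s x - u s y,
    FunctionSpaces.Torus.gradient (kk n) (x - y)⟫_ℝ‖ₑ with hρ_def
  have hρm : ∀ n, AEMeasurable (ρ n) μT := fun n => h.aemeasurable_lintegral_enorm_comm (hkS n)
  set Kρ : ℝ → ℝ≥0∞ := fun s => (C₁ : ℝ≥0∞) * FunctionSpaces.Torus.eGradNormSq (u s) ^ (1 / 2 : ℝ) *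
    ENNReal.ofReal (FunctionSpaces.Torus.gradProfileMass d) with hKρ
  have hKρt : ∫⁻ s, Kρ s ∂μT ≠ ⊤ := by
    rw [hKρ, lintegral_mul_const'' _ ((hGm.pow_const _).const_mul _), lintegral_const_mul'' _ (hGm.pow_const _)]
    exact ENNReal.mul_ne_top (ENNReal.mul_ne_top ENNReal.coe_ne_top hG.ne) ENNReal.ofReal_ne_top
  have hρle : ∀ n, ∀ᵐ s ∂μT, ρ n s ≤ Kρ s := by
    intro n
    filter_upwards [hgood] with s hs
    obtain ⟨-, -, hθ2, hθC, -, hu2, -⟩ := hs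
    refine (IsWeakScalarTransportOn.lintegral_enorm_comm_le_eGradNormSq hθ2 hu2 (hε n) (hε' n)).trans ?_
    simp only [hKρ]
    gcongr
  have hρ0 : ∀ᵐ s ∂μT, Tendsto (fun n => ρ n s) atTop (𝓝 0) := by
    filter_upwards [hgood] with s hs
    obtain ⟨⟨-, -, huθ⟩, hdiv, hθ2, -, hui, hu2, huG⟩ := hs
    exact tendsto_lintegral_enorm_comm hθ2 hui huθ hdiv (B := FunctionSpaces.Torus.eGradNormSq (u s) ^ (1 / 2 : ℝ))
      (ENNReal.rpow_ne_top_of_nonneg (by norm_num) huG.ne) hε hε' hε0 fun n z hz =>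
      IsWeakScalarTransportOn.eLpNorm_sub_translate_le_of_gradient_kernel_ne_zero hu2 (hε n) (hε' n) hz
  have hP0 : Tendsto (fun n => ∫⁻ s, ρ n s ∂μT) atTop (𝓝 0) := by
    have := tendsto_lintegral_of_dominated_convergence' Kρ hρm hρle hKρt
      (hρ0.mono fun s hs => by simpa using hs)
    simpa using this
  have hPt : ∀ n, ∫⁻ s, ρ n s ∂μT ≠ ⊤ := fun n =>
    ne_top_of_le_ne_top hKρt (lintegral_mono_ae (hρle n))
  -- ### the datum term (real form)
  set ar : ℝ := ∫ x, θ₀ x ^ 2 with har_def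
  have har : ENNReal.ofReal ar = ∫⁻ x, ‖θ₀ x‖ₑ ^ 2 := by
    rw [har_def, ofReal_integral_eq_lintegral_ofReal hθ₀.integrable_sq (ae_of_all _ fun x => sq_nonneg _)]
    refine lintegral_congr fun x => ?_
    rw [Real.enorm_eq_ofReal_abs, ← ENNReal.ofReal_pow (abs_nonneg _), sq_abs]
  have ha0 : ∀ n, ∫ x, (θ₀ ⋆ kk n) x ^ 2 ≤ ar := by
    intro n
    have hc : Continuous (θ₀ ⋆ kk n) := FunctionSpaces.Torus.continuous_convolution hθ₀i (hkS n).continuous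
    have h1 : eLpNorm (θ₀ ⋆ kk n) 2 volume ≤ eLpNorm θ₀ 2 volume :=
      calc eLpNorm (θ₀ ⋆ kk n) 2 volume ≤ (∫⁻ y, ‖kk n y‖ₑ) * eLpNorm θ₀ 2 volume :=
            FunctionSpaces.Torus.eLpNorm_convolution_le hθ₀.1 (hkS n).continuous.aestronglyMeasurable one_le_two
        _ = eLpNorm θ₀ 2 volume := by rw [hk1 n, one_mul]
    have h2 : ENNReal.ofReal (∫ x, (θ₀ ⋆ kk n) x ^ 2) ≤ ENNReal.ofReal ar := by
      rw [← lintegral_enorm_sq_eq_ofReal_integral_sq hc, ← PassiveScalarProofs.eLpNorm_two_pow_two, har,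
        ← PassiveScalarProofs.eLpNorm_two_pow_two]
      gcongr
    exact (ENNReal.ofReal_le_ofReal_iff hθ₀sq).1 h2
  -- ### the renormalised dissipation `D M n s = ∫ β_M''(A_n(s)) ‖∇A_n(s)‖²` (measurable form)
  set D : ℕ → ℕ → ℝ → ℝ := fun M n s => ∫ x, deriv (Calculus.renormDeriv (M : ℝ)) (∫ y, θ s y * kk n (x - y)) *
    ‖(θ s ⋆ FunctionSpaces.Torus.gradient (kk n)) x‖ ^ 2 with hD_def
  have hβ''c : ∀ M : ℕ, Continuous (deriv (Calculus.renormDeriv (M : ℝ))) := fun M =>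
    (Calculus.contDiff_renormDeriv (M : ℝ)).continuous_deriv (by simp)
  have hβ''b : ∀ (M : ℕ) (y : ℝ), 0 ≤ deriv (Calculus.renormDeriv (M : ℝ)) y ∧ deriv (Calculus.renormDeriv (M : ℝ)) y ≤ 2 := by
    intro M y
    rw [Calculus.deriv_renormDeriv]
    refine ⟨by positivity, ?_⟩
    have h1 := Calculus.abs_truncCutoff_le_one (M : ℝ) y
    rw [abs_le] at h1
    nlinarith [(Calculus.truncCutoff (M : ℝ)).nonneg (x := y)]
  have hDm : ∀ (M n : ℕ), AEStronglyMeasurable (D M n) μT := fun M n =>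
    h.aestronglyMeasurable_integral_comp_mul_norm_sq (hkS n) (hβ''c M)
  have hD0 : ∀ (M n : ℕ) (s : ℝ), 0 ≤ D M n s := fun M n s =>
    integral_nonneg fun x => mul_nonneg (hβ''b M _).1 (sq_nonneg _)
  have hDb : ∀ (M n : ℕ), ∃ K : ℝ, ∀ᵐ s ∂μT, D M n s ≤ K := by
    intro M n
    obtain ⟨Ck, hCk⟩ := FunctionSpaces.Torus.exists_forall_norm_le_of_continuous (hkS n).gradient.continuous
    refine ⟨2 * (Ck * C₁) ^ 2, ?_⟩
    filter_upwards [hgood] with s hs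
    obtain ⟨⟨hθi, -, -⟩, -, hθ2, hθC, -⟩ := hs
    have hpt : ∀ x, ‖(θ s ⋆ FunctionSpaces.Torus.gradient (kk n)) x‖ ≤ Ck * C₁ := fun x => by
      refine (FunctionSpaces.Torus.norm_convolution_le hθi hCk x).trans (mul_le_mul_of_nonneg_left ?_
        ((norm_nonneg _).trans (hCk 0)))
      have e : ∫ y, ‖θ s y‖ = ∫ y, |θ s y| := integral_congr_ae (Eventually.of_forall fun y => by
        simp [Real.norm_eq_abs])
      rw [e]
      exact integral_abs_le_of_eLpNorm_le hθ2 hθC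
    have hc : Continuous fun x => deriv (Calculus.renormDeriv (M : ℝ)) (∫ y, θ s y * kk n (x - y)) *
        ‖(θ s ⋆ FunctionSpaces.Torus.gradient (kk n)) x‖ ^ 2 := by
      refine ((hβ''c M).comp ?_).mul ((FunctionSpaces.Torus.continuous_convolution hθi (hkS n).gradient.continuous).norm.pow 2)
      have e : (fun x => ∫ y, θ s y * kk n (x - y)) = θ s ⋆ kk n := funext fun x => (hconv (θ s) n x).symm
      rw [e]
      exact FunctionSpaces.Torus.continuous_convolution hθi (hkS n).continuous
    calc D M n s ≤ ∫ _ : UnitAddTorus d, 2 * (Ck * C₁) ^ 2 := by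
          refine integral_mono hc.integrable_unitAddTorus (integrable_const _) fun x => ?_
          dsimp only
          exact mul_le_mul (hβ''b M _).2 (pow_le_pow_left₀ (norm_nonneg _) (hpt x) 2) (sq_nonneg _) zero_le_two
      _ = 2 * (Ck * C₁) ^ 2 := by simp
  have hDi : ∀ (M n : ℕ), Integrable (D M n) μT := by
    intro M n
    obtain ⟨K, hK⟩ := hDb M n
    refine Integrable.mono' (integrable_const (max K 0)) (hDm M n) ?_
    filter_upwards [hK] with s hs
    rw [Real.norm_eq_abs, abs_of_nonneg (hD0 M n s)]
    exact hs.trans (le_max_left _ _)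
  -- `D` versus the spectral dissipation of the truncated mollified slice, a.e.
  have hDe : ∀ (M n : ℕ), ∀ᵐ s ∂μT, ENNReal.ofReal (2 * κ) * eScalarGradNormSq (Calculus.trunc (M : ℝ) ∘ (θ s ⋆ kk n)) =
      ENNReal.ofReal (κ * D M n s) := by
    intro M n
    filter_upwards [hgood] with s hs
    obtain ⟨⟨hθi, -, -⟩, -⟩ := hs
    have hA : FunctionSpaces.Torus.IsSmooth (θ s ⋆ kk n) := FunctionSpaces.Torus.isSmooth_convolution hθi (hkS n)
    rw [← IsWeakScalarTransportOn.ofReal_mul_integral_renorm_dissipation hA (M : ℝ) hκ.le, hD_def]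
    congr 2
    refine integral_congr_ae (Eventually.of_forall fun x => ?_)
    dsimp only
    rw [← hconv (θ s) n x, FunctionSpaces.Torus.gradient_convolution hθi (hkS n) x]
  have hem : ∀ (M n : ℕ), AEMeasurable (fun s => ENNReal.ofReal (2 * κ) *
      eScalarGradNormSq (Calculus.trunc (M : ℝ) ∘ (θ s ⋆ kk n))) μT := fun M n =>
    (((hDm M n).aemeasurable.const_mul κ).ennreal_ofReal).congr ((hDe M n).mono fun s hs => hs.symm)
  -- ### the source terms
  set Q : ℕ → ℕ → ℝ → ℝ := fun M n τ => ∫ x, Calculus.renormDeriv (M : ℝ) (∫ y, θ τ y * kk n (x - y)) * Sn n x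
    with hQ_def
  set QM : ℕ → ℝ → ℝ := fun M τ => ∫ x, Calculus.renormDeriv (M : ℝ) (θ τ x) * f x with hQM_def
  set g : ℝ → ℝ := fun τ => ∫ x, θ τ x * f x with hg_def
  set Src : ℝ → ℝ := fun t => 2 * ∫ τ in Ioc 0 t, g τ with hSrc_def
  set SrcMn : ℕ → ℕ → ℝ → ℝ := fun M n t => ∫ τ in Ioc 0 t, Q M n τ with hSrcMn_def
  set SrcM : ℕ → ℝ → ℝ := fun M t => ∫ τ in Ioc 0 t, QM M τ with hSrcM_def
  set Cβ : ℕ → ℝ := fun M => 4 * ((Calculus.truncCutoff (M : ℝ)).rIn + 1) with hCβ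
  have hCβ0 : ∀ M, 0 ≤ Cβ M := fun M => by
    have := (Calculus.truncCutoff (M : ℝ)).rIn_pos; rw [hCβ]; positivity
  have hβ'b : ∀ (M : ℕ) (y : ℝ), |Calculus.renormDeriv (M : ℝ) y| ≤ Cβ M := fun M y =>
    Calculus.abs_renormDeriv_le_const (M : ℝ) y
  -- measurability and bounds of `Q`, `QM`
  have hQm : ∀ M n, AEStronglyMeasurable (Q M n) μT := by
    intro M n
    have hm : AEStronglyMeasurable (uncurry fun τ x => Calculus.renormDeriv (M : ℝ) (∫ y, θ τ y * kk n (x - y)) * Sn n x)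
        (μT.prod volume) :=
      ((Calculus.continuous_renormDeriv (M : ℝ)).comp_aestronglyMeasurable
        (h.aestronglyMeasurable_uncurry_molInt₁ (hkS n).continuous)).mul
        ((hSn_cont n).comp_aestronglyMeasurable measurable_snd.aestronglyMeasurable)
    exact hm.integral_prod_right'
  have hQb : ∀ M n τ, |Q M n τ| ≤ Cβ M * Cf := by
    intro M n τ
    rw [← Real.norm_eq_abs]
    refine (norm_integral_le_of_norm_le_const (C := Cβ M * Cf) (Eventually.of_forall fun x => ?_)).trans (le_of_eq ?_)
    · rw [norm_mul, Real.norm_eq_abs, Real.norm_eq_abs]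
      exact mul_le_mul (hβ'b M _) (hSn_le n x) (abs_nonneg _) (hCβ0 M)
    · rw [probReal_univ, mul_one]
  have hQi : ∀ M n, Integrable (Q M n) μT := fun M n =>
    Integrable.mono' (integrable_const (Cβ M * Cf)) (hQm M n) (Eventually.of_forall fun τ => by
      rw [Real.norm_eq_abs]; exact hQb M n τ)
  have hQMm : ∀ M, AEStronglyMeasurable (QM M) μT := by
    intro M
    have hm : AEStronglyMeasurable (uncurry fun τ x => Calculus.renormDeriv (M : ℝ) (θ τ x) * f x) (μT.prod volume) :=
      ((Calculus.continuous_renormDeriv (M : ℝ)).comp_aestronglyMeasurable h.aestronglyMeasurable_uncurry).mul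
        (hf.continuous.comp_aestronglyMeasurable measurable_snd.aestronglyMeasurable)
    exact hm.integral_prod_right'
  have hθ1 : ∀ᵐ τ ∂μT, ∫ x, |θ τ x| ≤ C₁ := by
    filter_upwards [hgood] with τ hτ
    exact integral_abs_le_of_eLpNorm_le hτ.2.2.1 hτ.2.2.2.1
  have hQMb : ∀ M, ∀ᵐ τ ∂μT, |QM M τ| ≤ 2 * Cf * C₁ := by
    intro M
    filter_upwards [hθ1, hgood] with τ hτ hg'
    obtain ⟨⟨hθi, -, -⟩, -⟩ := hg'
    calc |QM M τ| ≤ ∫ x, |Calculus.renormDeriv (M : ℝ) (θ τ x) * f x| := abs_integral_le_integral_abs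
      _ ≤ ∫ x, 2 * Cf * |θ τ x| := by
          refine integral_mono_of_nonneg (Eventually.of_forall fun x => abs_nonneg _) (hθi.abs.const_mul _)
            (Eventually.of_forall fun x => ?_)
          dsimp only
          rw [abs_mul]
          calc |Calculus.renormDeriv (M : ℝ) (θ τ x)| * |f x| ≤ 2 * |θ τ x| * Cf :=
                mul_le_mul (Calculus.abs_renormDeriv_le _ _) (by simpa [Real.norm_eq_abs] using hCf x) (abs_nonneg _)
                  (by positivity)
            _ = 2 * Cf * |θ τ x| := by ring
      _ = 2 * Cf * ∫ x, |θ τ x| := MeasureTheory.integral_const_mul _ _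
      _ ≤ 2 * Cf * C₁ := mul_le_mul_of_nonneg_left hτ (by positivity)
  have hQMi : ∀ M, Integrable (QM M) μT := fun M =>
    Integrable.mono' (integrable_const (2 * Cf * C₁)) (hQMm M) ((hQMb M).mono fun τ hτ => by
      rw [Real.norm_eq_abs]; exact hτ)
  have hgi : Integrable g μT := (h.integrable_mul_continuous hf.continuous).integral_prod_left
  -- convergence `Q M n τ → QM M τ` (`n → ∞`) at good `τ`
  have hE0 : ∀ᵐ s ∂μT, Tendsto (fun n => eLpNorm (θ s ⋆ kk n - θ s) 2 volume) atTop (𝓝 0) := by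
    filter_upwards [hgood] with s hs
    exact FunctionSpaces.Torus.tendsto_eLpNorm_convolution_sub_self hs.2.2.1
      (fun n y => FunctionSpaces.Torus.kernel_nonneg (hε n).le y)
      (fun n => FunctionSpaces.Torus.integral_kernel (hε n) (hε' n)) (fun n => FunctionSpaces.Torus.support_kernel_subset (hε n))
      (fun n => FunctionSpaces.Torus.continuous_kernel (hε n) (hε' n)) hε0
  have hQlim : ∀ M, ∀ᵐ τ ∂μT, Tendsto (fun n => Q M n τ) atTop (𝓝 (QM M τ)) := by
    intro M
    filter_upwards [hgood, hE0, hθ1] with τ hτ hτ0 hτ1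
    obtain ⟨⟨hθi, -, -⟩, -, hθ2, hθC, -⟩ := hτ
    rw [Metric.tendsto_atTop]
    intro η hη
    have hη' : 0 < η / (2 * (Cf + C₁ + 1)) := by positivity
    obtain ⟨N₁, hN₁⟩ := eventually_atTop.1 (hSn_unif _ hη')
    have hev2 : ∀ᶠ n in atTop, eLpNorm (θ τ ⋆ kk n - θ τ) 2 volume ≤ ENNReal.ofReal (η / (2 * (Cf + C₁ + 1))) := by
      have := (ENNReal.tendsto_nhds_zero.1 hτ0) (ENNReal.ofReal (η / (2 * (Cf + C₁ + 1)))) (ENNReal.ofReal_pos.2 hη')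
      exact this
    obtain ⟨N₂, hN₂⟩ := eventually_atTop.1 hev2
    refine ⟨max N₁ N₂, fun n hn => ?_⟩
    have hn1 := hN₁ n ((le_max_left _ _).trans hn)
    have hn2 := hN₂ n ((le_max_right _ _).trans hn)
    have hAi : Integrable (θ τ ⋆ kk n) volume :=
      (FunctionSpaces.Torus.continuous_convolution hθi (hkS n).continuous).integrable_unitAddTorus
    have hdiffL1 : ∫ x, |(θ τ ⋆ kk n) x - θ τ x| ≤ η / (2 * (Cf + C₁ + 1)) := by
      have hmem : MemLp (θ τ ⋆ kk n - θ τ) 2 volume :=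
        ((FunctionSpaces.Torus.isSmooth_convolution hθi (hkS n)).memLp 2).sub hθ2
      exact integral_abs_le_of_eLpNorm_le hmem (C := ⟨η / (2 * (Cf + C₁ + 1)), hη'.le⟩)
        (hn2.trans_eq (ENNReal.ofReal_eq_coe_nnreal hη'.le))
    -- split `Q - QM`
    have i1 : Integrable (fun x => Calculus.renormDeriv (M : ℝ) ((θ τ ⋆ kk n) x) * Sn n x) volume :=
      (((Calculus.continuous_renormDeriv _).comp (FunctionSpaces.Torus.continuous_convolution hθi (hkS n).continuous)).mul
        (hSn_cont n)).integrable_unitAddTorus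
    have i2 : Integrable (fun x => Calculus.renormDeriv (M : ℝ) (θ τ x) * Sn n x) volume := by
      refine Integrable.mono' (hθi.abs.const_mul (2 * Cf)) (((Calculus.continuous_renormDeriv _).comp_aestronglyMeasurable
        hθi.aestronglyMeasurable).mul (hSn_cont n).aestronglyMeasurable) (Eventually.of_forall fun x => ?_)
      rw [norm_mul, Real.norm_eq_abs, Real.norm_eq_abs]
      calc |Calculus.renormDeriv (M : ℝ) (θ τ x)| * |Sn n x| ≤ 2 * |θ τ x| * Cf :=
            mul_le_mul (Calculus.abs_renormDeriv_le _ _) (hSn_le n x) (abs_nonneg _) (by positivity)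
        _ = 2 * Cf * |θ τ x| := by ring
    have i3 : Integrable (fun x => Calculus.renormDeriv (M : ℝ) (θ τ x) * f x) volume := by
      refine Integrable.mono' (hθi.abs.const_mul (2 * Cf)) (((Calculus.continuous_renormDeriv _).comp_aestronglyMeasurable
        hθi.aestronglyMeasurable).mul hf.continuous.aestronglyMeasurable) (Eventually.of_forall fun x => ?_)
      rw [norm_mul, Real.norm_eq_abs, Real.norm_eq_abs]
      calc |Calculus.renormDeriv (M : ℝ) (θ τ x)| * |f x| ≤ 2 * |θ τ x| * Cf :=
            mul_le_mul (Calculus.abs_renormDeriv_le _ _) (by simpa [Real.norm_eq_abs] using hCf x) (abs_nonneg _) (by positivity)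
        _ = 2 * Cf * |θ τ x| := by ring
    have eQ : Q M n τ = ∫ x, Calculus.renormDeriv (M : ℝ) ((θ τ ⋆ kk n) x) * Sn n x := by
      simp only [hQ_def, hconv]
    have hd1 : |(∫ x, Calculus.renormDeriv (M : ℝ) ((θ τ ⋆ kk n) x) * Sn n x) -
        ∫ x, Calculus.renormDeriv (M : ℝ) (θ τ x) * Sn n x| ≤ 2 * Cf * (η / (2 * (Cf + C₁ + 1))) := by
      rw [← integral_sub i1 i2]
      calc |∫ x, (Calculus.renormDeriv (M : ℝ) ((θ τ ⋆ kk n) x) * Sn n x - Calculus.renormDeriv (M : ℝ) (θ τ x) * Sn n x)|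
          ≤ ∫ x, |Calculus.renormDeriv (M : ℝ) ((θ τ ⋆ kk n) x) * Sn n x - Calculus.renormDeriv (M : ℝ) (θ τ x) * Sn n x| :=
            abs_integral_le_integral_abs
        _ ≤ ∫ x, 2 * Cf * |(θ τ ⋆ kk n) x - θ τ x| := by
            refine integral_mono_of_nonneg (Eventually.of_forall fun x => abs_nonneg _) ((hAi.sub hθi).abs.const_mul _)
              (Eventually.of_forall fun x => ?_)
            dsimp only
            rw [← sub_mul, abs_mul]
            calc |Calculus.renormDeriv (M : ℝ) ((θ τ ⋆ kk n) x) - Calculus.renormDeriv (M : ℝ) (θ τ x)| * |Sn n x|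
                ≤ 2 * |(θ τ ⋆ kk n) x - θ τ x| * Cf :=
                  mul_le_mul (abs_renormDeriv_sub_le _ _ _) (hSn_le n x) (abs_nonneg _) (by positivity)
              _ = 2 * Cf * |(θ τ ⋆ kk n) x - θ τ x| := by ring
        _ = 2 * Cf * ∫ x, |(θ τ ⋆ kk n) x - θ τ x| := MeasureTheory.integral_const_mul _ _
        _ ≤ 2 * Cf * (η / (2 * (Cf + C₁ + 1))) := mul_le_mul_of_nonneg_left (by simpa using hdiffL1) (by positivity)
    have hd2 : |(∫ x, Calculus.renormDeriv (M : ℝ) (θ τ x) * Sn n x) - QM M τ| ≤ 2 * C₁ * (η / (2 * (Cf + C₁ + 1))) := by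
      rw [hQM_def]
      dsimp only
      rw [← integral_sub i2 i3]
      calc |∫ x, (Calculus.renormDeriv (M : ℝ) (θ τ x) * Sn n x - Calculus.renormDeriv (M : ℝ) (θ τ x) * f x)|
          ≤ ∫ x, |Calculus.renormDeriv (M : ℝ) (θ τ x) * Sn n x - Calculus.renormDeriv (M : ℝ) (θ τ x) * f x| :=
            abs_integral_le_integral_abs
        _ ≤ ∫ x, 2 * (η / (2 * (Cf + C₁ + 1))) * |θ τ x| := by
            refine integral_mono_of_nonneg (Eventually.of_forall fun x => abs_nonneg _) (hθi.abs.const_mul _)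
              (Eventually.of_forall fun x => ?_)
            dsimp only
            rw [← mul_sub, abs_mul]
            calc |Calculus.renormDeriv (M : ℝ) (θ τ x)| * |Sn n x - f x| ≤ 2 * |θ τ x| * (η / (2 * (Cf + C₁ + 1))) :=
                  mul_le_mul (Calculus.abs_renormDeriv_le _ _) (hn1 x) (abs_nonneg _) (by positivity)
              _ = 2 * (η / (2 * (Cf + C₁ + 1))) * |θ τ x| := by ring
        _ = 2 * (η / (2 * (Cf + C₁ + 1))) * ∫ x, |θ τ x| := MeasureTheory.integral_const_mul _ _
        _ ≤ 2 * (η / (2 * (Cf + C₁ + 1))) * C₁ := mul_le_mul_of_nonneg_left hτ1 (by positivity)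
        _ = 2 * C₁ * (η / (2 * (Cf + C₁ + 1))) := by ring
    rw [Real.dist_eq, eQ]
    have hsum : |(∫ x, Calculus.renormDeriv (M : ℝ) ((θ τ ⋆ kk n) x) * Sn n x) - QM M τ| ≤
        (2 * Cf + 2 * C₁) * (η / (2 * (Cf + C₁ + 1))) := by
      calc _ ≤ |(∫ x, Calculus.renormDeriv (M : ℝ) ((θ τ ⋆ kk n) x) * Sn n x) -
              ∫ x, Calculus.renormDeriv (M : ℝ) (θ τ x) * Sn n x| +
            |(∫ x, Calculus.renormDeriv (M : ℝ) (θ τ x) * Sn n x) - QM M τ| := abs_sub_le _ _ _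
        _ ≤ _ := by linarith [hd1, hd2]
    have hlt : (2 * Cf + 2 * C₁) * (η / (2 * (Cf + C₁ + 1))) < η := by
      rw [← mul_div_assoc, div_lt_iff₀ (by positivity)]
      nlinarith [hCf0, C₁.coe_nonneg]
    exact hsum.trans_lt hlt
  -- `SrcMn M n t → SrcM M t` for `t ∈ (0,T)`
  have hSrcMn_lim : ∀ M, ∀ t ∈ Ioo 0 T, Tendsto (fun n => SrcMn M n t) atTop (𝓝 (SrcM M t)) := by
    intro M t ht
    have hsub : Ioc 0 t ⊆ Ioo 0 T := Ioc_subset_Ioo_right ht.2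
    have hle : (volume : Measure ℝ).restrict (Ioc 0 t) ≤ μT := Measure.restrict_mono_set _ hsub
    haveI : IsFiniteMeasure ((volume : Measure ℝ).restrict (Ioc 0 t)) := by infer_instance
    refine tendsto_integral_of_dominated_convergence (fun _ => Cβ M * Cf) (fun n => (hQm M n).mono_measure hle)
      (integrable_const _) (fun n => Eventually.of_forall fun τ => ?_) (ae_restrict_of_ae_restrict_of_subset hsub (hQlim M))
    rw [Real.norm_eq_abs]
    exact hQb M n τ
  -- `SrcM M t → Src t` (`M → ∞`) for `t ∈ (0,T)`
  have hQMlim : ∀ᵐ τ ∂μT, Tendsto (fun M : ℕ => QM M τ) atTop (𝓝 (2 * g τ)) := by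
    filter_upwards [hgood] with τ hτ
    obtain ⟨⟨hθi, -, -⟩, -⟩ := hτ
    have e2 : 2 * g τ = ∫ x, 2 * θ τ x * f x := by
      simp only [hg_def]
      rw [← MeasureTheory.integral_const_mul]
      exact integral_congr_ae (Eventually.of_forall fun x => by ring)
    rw [e2]
    refine tendsto_integral_of_dominated_convergence (fun x => 2 * Cf * |θ τ x|) (fun M => ?_) (hθi.abs.const_mul _)
      (fun M => Eventually.of_forall fun x => ?_) (Eventually.of_forall fun x => ?_)
    · exact ((Calculus.continuous_renormDeriv _).comp_aestronglyMeasurable hθi.aestronglyMeasurable).mul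
        hf.continuous.aestronglyMeasurable
    · rw [norm_mul, Real.norm_eq_abs, Real.norm_eq_abs]
      calc |Calculus.renormDeriv (M : ℝ) (θ τ x)| * |f x| ≤ 2 * |θ τ x| * Cf :=
            mul_le_mul (Calculus.abs_renormDeriv_le _ _) (by simpa [Real.norm_eq_abs] using hCf x) (abs_nonneg _) (by positivity)
        _ = 2 * Cf * |θ τ x| := by ring
    · refine tendsto_const_nhds.congr' ?_
      filter_upwards [eventually_ge_atTop ⌈|θ τ x|⌉₊] with M hM
      rw [renormDeriv_eq_two_mul ((Nat.le_ceil _).trans (Nat.cast_le.2 hM))]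
  have hSrcM_lim : ∀ t ∈ Ioo 0 T, Tendsto (fun M : ℕ => SrcM M t) atTop (𝓝 (Src t)) := by
    intro t ht
    have hsub : Ioc 0 t ⊆ Ioo 0 T := Ioc_subset_Ioo_right ht.2
    have hle : (volume : Measure ℝ).restrict (Ioc 0 t) ≤ μT := Measure.restrict_mono_set _ hsub
    haveI : IsFiniteMeasure ((volume : Measure ℝ).restrict (Ioc 0 t)) := by infer_instance
    have e : Src t = ∫ τ in Ioc 0 t, 2 * g τ := by
      simp only [hSrc_def]
      exact (MeasureTheory.integral_const_mul _ _).symm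
    rw [e]
    refine tendsto_integral_of_dominated_convergence (fun _ => 2 * Cf * C₁) (fun M => (hQMm M).mono_measure hle)
      (integrable_const _) (fun M => ?_) (ae_restrict_of_ae_restrict_of_subset hsub hQMlim)
    refine ae_restrict_of_ae_restrict_of_subset hsub ((hQMb M).mono fun τ hτ => ?_)
    rw [Real.norm_eq_abs]
    exact hτ
  -- ### **the core estimate** (real form): for a.e. `t`,
  --     `κ ∫_{(0,t]} D_{M,n} ≤ ar + Cβ_M (∫⁻ ρ_n).toReal + SrcMn M n t`
  have hKρfin : ∀ᵐ s ∂μT, Kρ s < ⊤ :=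
    ae_lt_top' (((hGm.pow_const _).const_mul _).mul_const _) hKρt
  have hcore : ∀ (M n : ℕ), ∀ᵐ t ∂μT, κ * ∫ s in Ioc 0 t, D M n s ≤
      ar + Cβ M * (∫⁻ s, ρ n s ∂μT).toReal + SrcMn M n t := by
    intro M n
    have hβ : ContDiff ℝ 1 (Calculus.renorm (M : ℝ)) := (Calculus.contDiff_renorm (M : ℝ)).of_le (by simp)
    have hβtop : ContDiff ℝ ∞ (Calculus.renorm (M : ℝ)) := Calculus.contDiff_renorm (M : ℝ)
    have hβK := Calculus.lipschitzWith_renorm (M : ℝ)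
    have hβ'bd : ∀ y, |deriv (Calculus.renorm (M : ℝ)) y| ≤ Cβ M := fun y => by
      rw [Calculus.deriv_renorm]; exact hβ'b M y
    have hβ'c : Continuous (deriv (Calculus.renorm (M : ℝ))) := hβ.continuous_deriv le_rfl
    -- the time-integrands on `(0,T)`
    set Φ : ℝ → ℝ := fun s => ∫ x, deriv (Calculus.renorm (M : ℝ)) (∫ y, θ s y * kk n (x - y)) *
      ((∫ y, θ s y * (-⟪u s y, FunctionSpaces.Torus.gradient (kk n) (x - y)⟫_ℝ + κ * FunctionSpaces.Torus.laplacian (kk n) (x - y))) +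
        ∫ y, f y * kk n (x - y)) with hΦ_def
    set R : ℝ → ℝ := fun s => ∫ x, deriv (Calculus.renorm (M : ℝ)) ((θ s ⋆ kk n) x) *
      ∫ y, θ s y * ⟪u s x - u s y, FunctionSpaces.Torus.gradient (kk n) (x - y)⟫_ℝ with hR_def
    have hΦi : Integrable Φ μT := (h.integrable_comp_molInt_mul_flux (hkS n) hβ'c hβ'bd).integral_prod_left
    -- the slice identity `Φ = R - κ D + Q` a.e.
    have hslice : ∀ᵐ s ∂μT, Φ s = R s - κ * D M n s + Q M n s := by
      filter_upwards [hgood] with s hs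
      obtain ⟨⟨hθi, hum, huθ⟩, hdiv, -, -, hui, -⟩ := hs
      have hid := integral_deriv_comp_mul_flux_eq hβtop hθi hui huθ hdiv (hkS n) κ
      have hA : FunctionSpaces.Torus.IsSmooth (θ s ⋆ kk n) := FunctionSpaces.Torus.isSmooth_convolution hθi (hkS n)
      have hbc : Continuous fun x => deriv (Calculus.renorm (M : ℝ)) ((θ s ⋆ kk n) x) := hβ'c.comp hA.continuous
      have hGc := continuous_fluxIntegral hθi hum huθ (hkS n) κ
      have jG : Integrable (fun x => deriv (Calculus.renorm (M : ℝ)) ((θ s ⋆ kk n) x) *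
          ∫ y, θ s y * (-⟪u s y, FunctionSpaces.Torus.gradient (kk n) (x - y)⟫_ℝ + κ * FunctionSpaces.Torus.laplacian (kk n) (x - y)))
          volume := (hbc.mul hGc).integrable_unitAddTorus
      have jS : Integrable (fun x => deriv (Calculus.renorm (M : ℝ)) ((θ s ⋆ kk n) x) * Sn n x) volume :=
        (hbc.mul (hSn_cont n)).integrable_unitAddTorus
      have e1 : Φ s = ∫ x, (deriv (Calculus.renorm (M : ℝ)) ((θ s ⋆ kk n) x) *
          (∫ y, θ s y * (-⟪u s y, FunctionSpaces.Torus.gradient (kk n) (x - y)⟫_ℝ + κ * FunctionSpaces.Torus.laplacian (kk n) (x - y))) +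
          deriv (Calculus.renorm (M : ℝ)) ((θ s ⋆ kk n) x) * Sn n x) := by
        simp only [hΦ_def, hconv, hSn_def, mul_add]
      have e2 : D M n s = ∫ x, deriv (deriv (Calculus.renorm (M : ℝ))) ((θ s ⋆ kk n) x) *
          ‖FunctionSpaces.Torus.gradient (θ s ⋆ kk n) x‖ ^ 2 := by
        simp only [hD_def]
        refine integral_congr_ae (Eventually.of_forall fun x => ?_)
        dsimp only
        rw [Calculus.deriv_renorm, ← hconv (θ s) n x, FunctionSpaces.Torus.gradient_convolution hθi (hkS n) x]
      have e3 : Q M n s = ∫ x, deriv (Calculus.renorm (M : ℝ)) ((θ s ⋆ kk n) x) * Sn n x := by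
        simp only [hQ_def, Calculus.deriv_renorm, hconv]
      rw [e1, integral_add jG jS, hid, e2, e3]
    -- the bound `|R| ≤ C_M ρ` a.e.
    have hRle : ∀ᵐ s ∂μT, |R s| ≤ Cβ M * (ρ n s).toReal := by
      filter_upwards [hρle n, hgood, hKρfin] with s hs hg' hKs
      obtain ⟨⟨hθi, hum, -⟩, -⟩ := hg'
      have hKc : Continuous fun p : UnitAddTorus d × UnitAddTorus d =>
          FunctionSpaces.Torus.gradient (kk n) (p.1 - p.2) :=
        (hkS n).gradient.continuous.comp (continuous_fst.sub continuous_snd)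
      have hP : AEStronglyMeasurable (Function.uncurry fun (x y : UnitAddTorus d) => θ s y * ⟪u s x - u s y,
          FunctionSpaces.Torus.gradient (kk n) (x - y)⟫_ℝ) ((volume : Measure (UnitAddTorus d)).prod volume) :=
        (hθi.aestronglyMeasurable.comp_snd).mul (((hum.comp_fst).sub (hum.comp_snd)).inner hKc.aestronglyMeasurable)
      have hrm : AEStronglyMeasurable (fun x => ∫ y, θ s y * ⟪u s x - u s y,
          FunctionSpaces.Torus.gradient (kk n) (x - y)⟫_ℝ) volume := hP.integral_prod_right'
      exact IsWeakScalarTransportOn.abs_integral_mul_le_mul_toReal_lintegral (fun x => hβ'bd _) hrm (hs.trans_lt hKs)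
    -- `R` is integrable on `(0,T)`
    have hRm : AEStronglyMeasurable R μT := by
      have e : R =ᵐ[μT] fun s => Φ s + κ * D M n s - Q M n s := by
        filter_upwards [hslice] with s hs
        rw [hs]; ring
      exact ((hΦi.aestronglyMeasurable.add ((hDm M n).const_mul κ)).sub (hQm M n)).congr e.symm
    have hRi : Integrable R μT := by
      refine Integrable.mono' ((integrable_toReal_of_lintegral_ne_top (hρm n) (hPt n)).const_mul (Cβ M)) hRm ?_
      filter_upwards [hRle] with s hs
      rw [Real.norm_eq_abs]
      exact hs
    -- now the good times
    filter_upwards [h.ae_integral_comp_molInt_eq hθ₀i (hkS n) hβ hβK, ae_restrict_mem measurableSet_Ioo]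
      with t hid htT
    have hsub : Ioc 0 t ⊆ Ioo 0 T := Ioc_subset_Ioo_right htT.2
    have hle : (volume : Measure ℝ).restrict (Ioc 0 t) ≤ μT := Measure.restrict_mono_set _ hsub
    have hΦi' : IntegrableOn Φ (Ioc 0 t) volume := hΦi.mono_measure hle
    have hDi' : IntegrableOn (D M n) (Ioc 0 t) volume := (hDi M n).mono_measure hle
    have hRi' : IntegrableOn R (Ioc 0 t) volume := hRi.mono_measure hle
    have hQi' : IntegrableOn (Q M n) (Ioc 0 t) volume := (hQi M n).mono_measure hle
    -- `∫_{(0,t]} Φ = ∫_{(0,t]} R - κ ∫_{(0,t]} D + ∫_{(0,t]} Q`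
    have hsplit : ∫ s in Ioc 0 t, Φ s =
        (∫ s in Ioc 0 t, R s) - κ * (∫ s in Ioc 0 t, D M n s) + ∫ s in Ioc 0 t, Q M n s := by
      have i2 : Integrable (fun s => κ * D M n s) ((volume : Measure ℝ).restrict (Ioc 0 t)) := hDi'.const_mul κ
      have i1 : Integrable (fun s => R s - κ * D M n s) ((volume : Measure ℝ).restrict (Ioc 0 t)) := hRi'.sub i2
      have e : ∫ s in Ioc 0 t, Φ s = ∫ s in Ioc 0 t, (R s - κ * D M n s + Q M n s) :=
        integral_congr_ae (ae_restrict_of_ae_restrict_of_subset hsub hslice)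
      rw [e, integral_add i1 hQi', integral_sub hRi' i2, MeasureTheory.integral_const_mul]
    -- the renormalised identity in real form
    have hidΦ : ∫ x, Calculus.renorm (M : ℝ) (∫ y, θ t y * kk n (x - y)) =
        (∫ x, Calculus.renorm (M : ℝ) (∫ y, θ₀ y * kk n (x - y))) + ∫ s in Ioc 0 t, Φ s := by
      simpa only using hid
    have hpos : 0 ≤ ∫ x, Calculus.renorm (M : ℝ) (∫ y, θ t y * kk n (x - y)) :=
      integral_nonneg fun x => Calculus.renorm_nonneg _ _
    have hdat : ∫ x, Calculus.renorm (M : ℝ) (∫ y, θ₀ y * kk n (x - y)) ≤ ∫ x, (θ₀ ⋆ kk n) x ^ 2 := by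
      have hc : Continuous (θ₀ ⋆ kk n) := FunctionSpaces.Torus.continuous_convolution hθ₀i (hkS n).continuous
      have e : (fun x => Calculus.renorm (M : ℝ) (∫ y, θ₀ y * kk n (x - y))) = fun x => Calculus.renorm (M : ℝ) ((θ₀ ⋆ kk n) x) :=
        funext fun x => by rw [hconv]
      rw [e]
      exact integral_mono ((Calculus.contDiff_renorm (M : ℝ)).continuous.comp hc).integrable_unitAddTorus
        (hc.pow 2).integrable_unitAddTorus fun x => Calculus.renorm_le_sq _ _
    have hRabs : ∫ s in Ioc 0 t, R s ≤ Cβ M * ∫ s in Ioc 0 t, (ρ n s).toReal := by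
      rw [← MeasureTheory.integral_const_mul]
      refine integral_mono_ae hRi' ((integrable_toReal_of_lintegral_ne_top (hρm n) (hPt n)).const_mul (Cβ M)
        |>.mono_measure hle) ?_
      exact ae_restrict_of_ae_restrict_of_subset hsub (hRle.mono fun s hs => (le_abs_self _).trans hs)
    have hρint : ∫ s in Ioc 0 t, (ρ n s).toReal ≤ (∫⁻ s, ρ n s ∂μT).toReal := by
      have h1 : ∫ s in Ioc 0 t, (ρ n s).toReal ≤ ∫ s, (ρ n s).toReal ∂μT :=
        integral_mono_measure hle (Eventually.of_forall fun s => ENNReal.toReal_nonneg)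
          (integrable_toReal_of_lintegral_ne_top (hρm n) (hPt n))
      have h2 : ∫ s, (ρ n s).toReal ∂μT = (∫⁻ s, ρ n s ∂μT).toReal :=
        integral_toReal (hρm n) ((hρle n).mp (hKρfin.mono fun s h1 h2 => h2.trans_lt h1))
      exact h1.trans h2.le
    have hsrc : ∫ s in Ioc 0 t, Q M n s = SrcMn M n t := rfl
    have := mul_le_mul_of_nonneg_left hρint (hCβ0 M)
    linarith [hidΦ, hpos, hdat, ha0 n, hsplit, hRabs]
  -- ### lower semicontinuity, twice
  have h2κ : (2 : ℝ≥0∞) * ENNReal.ofReal κ = ENNReal.ofReal (2 * κ) := by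
    rw [ENNReal.ofReal_mul zero_le_two, ENNReal.ofReal_ofNat]
  have hlsc_n : ∀ᵐ s ∂μT, ∀ M : ℕ, ENNReal.ofReal (2 * κ) * eScalarGradNormSq (Calculus.trunc (M : ℝ) ∘ θ s) ≤
      liminf (fun n => ENNReal.ofReal (2 * κ) * eScalarGradNormSq (Calculus.trunc (M : ℝ) ∘ (θ s ⋆ kk n))) atTop := by
    filter_upwards [hgood, hE0] with s hs hs0 M
    obtain ⟨⟨hθi, -, -⟩, -, hθ2, -⟩ := hs
    have hSc : Continuous (Calculus.trunc (M : ℝ)) := (Calculus.contDiff_trunc (M : ℝ)).continuous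
    have hSθi : Integrable (Calculus.trunc (M : ℝ) ∘ θ s) volume := by
      refine Integrable.mono' hθi.norm (hSc.comp_aestronglyMeasurable hθi.aestronglyMeasurable)
        (Eventually.of_forall fun x => ?_)
      rw [Function.comp_apply, Real.norm_eq_abs, Real.norm_eq_abs]
      exact Calculus.abs_trunc_le _ _
    have hSAi : ∀ n, Integrable (Calculus.trunc (M : ℝ) ∘ (θ s ⋆ kk n)) volume := fun n =>
      (hSc.comp (FunctionSpaces.Torus.continuous_convolution hθi (hkS n).continuous)).integrable_unitAddTorus
    refine mul_eScalarGradNormSq_le_liminf hSθi hSAi ?_ ENNReal.ofReal_ne_top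
    refine tendsto_of_tendsto_of_tendsto_of_le_of_le tendsto_const_nhds hs0 (fun n => bot_le) fun n => ?_
    exact IsWeakScalarTransportOn.eLpNorm_trunc_comp_sub_le (M : ℝ) (θ s ⋆ kk n) (θ s)
  have hlsc_M : ∀ᵐ s ∂μT, ENNReal.ofReal (2 * κ) * eScalarGradNormSq (θ s) ≤
      liminf (fun M : ℕ => ENNReal.ofReal (2 * κ) * eScalarGradNormSq (Calculus.trunc (M : ℝ) ∘ θ s)) atTop := by
    filter_upwards [hgood] with s hs
    obtain ⟨⟨hθi, -, -⟩, -, hθ2, -⟩ := hs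
    have hSθi : ∀ M : ℕ, Integrable (Calculus.trunc (M : ℝ) ∘ θ s) volume := fun M => by
      refine Integrable.mono' hθi.norm ((Calculus.contDiff_trunc (M : ℝ)).continuous.comp_aestronglyMeasurable
        hθi.aestronglyMeasurable) (Eventually.of_forall fun x => ?_)
      rw [Function.comp_apply, Real.norm_eq_abs, Real.norm_eq_abs]
      exact Calculus.abs_trunc_le _ _
    refine mul_eScalarGradNormSq_le_liminf hθi hSθi ?_ ENNReal.ofReal_ne_top
    exact IsWeakScalarTransportOn.tendsto_eLpNorm_trunc_comp_sub hθ2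
  -- ### at a.e. `t`: the Fatou chain and the real budget
  have hmain : ∀ᵐ t ∂μT, (∫⁻ s in Ioo 0 t, ENNReal.ofReal (2 * κ) * eScalarGradNormSq (θ s)) ≤
      ENNReal.ofReal (ar + Src t) ∧ 0 ≤ ar + Src t := by
    have hcore' : ∀ᵐ t ∂μT, ∀ M n, κ * ∫ s in Ioc 0 t, D M n s ≤
        ar + Cβ M * (∫⁻ s, ρ n s ∂μT).toReal + SrcMn M n t :=
      ae_all_iff.2 fun M => ae_all_iff.2 fun n => hcore M n
    filter_upwards [hcore', ae_restrict_mem measurableSet_Ioo] with t hct htT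
    have hsub : Ioo 0 t ⊆ Ioo 0 T := Ioo_subset_Ioo_right htT.2.le
    set μt : Measure ℝ := (volume : Measure ℝ).restrict (Ioo 0 t) with hμt
    have hle : μt ≤ μT := Measure.restrict_mono_set _ hsub
    set e : ℕ → ℕ → ℝ := fun M n => |SrcMn M n t - Src t| with he_def
    have ht_bound : ∀ (M n : ℕ), ∫⁻ s, ENNReal.ofReal (2 * κ) * eScalarGradNormSq (Calculus.trunc (M : ℝ) ∘ (θ s ⋆ kk n)) ∂μt ≤
        ENNReal.ofReal (ar + Src t) + ENNReal.ofReal (Cβ M) * (∫⁻ s, ρ n s ∂μT) + ENNReal.ofReal (e M n) := by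
      intro M n
      have hreal' : κ * ∫ s in Ioc 0 t, D M n s ≤ (ar + Src t) + Cβ M * (∫⁻ s, ρ n s ∂μT).toReal + e M n := by
        have h1 : SrcMn M n t ≤ Src t + e M n := by
          have := le_abs_self (SrcMn M n t - Src t)
          simp only [he_def]; linarith
        linarith [hct M n]
      calc ∫⁻ s, ENNReal.ofReal (2 * κ) * eScalarGradNormSq (Calculus.trunc (M : ℝ) ∘ (θ s ⋆ kk n)) ∂μt
          = ∫⁻ s, ENNReal.ofReal (κ * D M n s) ∂μt :=
            lintegral_congr_ae (ae_restrict_of_ae_restrict_of_subset hsub (hDe M n))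
        _ = ENNReal.ofReal (κ * ∫ s in Ioo 0 t, D M n s) := by
            rw [← MeasureTheory.integral_const_mul, ofReal_integral_eq_lintegral_ofReal
              (((hDi M n).mono_measure hle).const_mul κ) (Eventually.of_forall fun s => mul_nonneg hκ.le (hD0 M n s))]
        _ = ENNReal.ofReal (κ * ∫ s in Ioc 0 t, D M n s) := by rw [integral_Ioc_eq_integral_Ioo]
        _ ≤ ENNReal.ofReal ((ar + Src t) + Cβ M * (∫⁻ s, ρ n s ∂μT).toReal + e M n) := ENNReal.ofReal_le_ofReal hreal'
        _ ≤ ENNReal.ofReal ((ar + Src t) + Cβ M * (∫⁻ s, ρ n s ∂μT).toReal) + ENNReal.ofReal (e M n) :=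
            ENNReal.ofReal_add_le (p := (ar + Src t) + Cβ M * (∫⁻ s, ρ n s ∂μT).toReal) (q := e M n)
        _ ≤ ENNReal.ofReal (ar + Src t) + ENNReal.ofReal (Cβ M * (∫⁻ s, ρ n s ∂μT).toReal) + ENNReal.ofReal (e M n) :=
            add_le_add (ENNReal.ofReal_add_le (p := ar + Src t) (q := Cβ M * (∫⁻ s, ρ n s ∂μT).toReal)) le_rfl
        _ = ENNReal.ofReal (ar + Src t) + ENNReal.ofReal (Cβ M) * (∫⁻ s, ρ n s ∂μT) + ENNReal.ofReal (e M n) := by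
            rw [ENNReal.ofReal_mul (hCβ0 M), ENNReal.ofReal_toReal (hPt n)]
    -- the limits of the right-hand sides
    have hlim_n : ∀ M : ℕ, Tendsto (fun n : ℕ => ENNReal.ofReal (ar + Src t) + ENNReal.ofReal (Cβ M) * (∫⁻ s, ρ n s ∂μT) +
        ENNReal.ofReal (e M n)) atTop (𝓝 (ENNReal.ofReal (ar + Src t) + ENNReal.ofReal |SrcM M t - Src t|)) := by
      intro M
      have h1 : Tendsto (fun n => ENNReal.ofReal (Cβ M) * ∫⁻ s, ρ n s ∂μT) atTop (𝓝 0) := by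
        have := ENNReal.Tendsto.const_mul hP0 (Or.inr ENNReal.ofReal_ne_top : (0 : ℝ≥0∞) ≠ 0 ∨ ENNReal.ofReal (Cβ M) ≠ ⊤)
        rwa [mul_zero] at this
      have h2 : Tendsto (fun n => ENNReal.ofReal (e M n)) atTop (𝓝 (ENNReal.ofReal |SrcM M t - Src t|)) :=
        ENNReal.tendsto_ofReal (((hSrcMn_lim M t htT).sub_const (Src t)).abs)
      have h3 := ((tendsto_const_nhds (x := ENNReal.ofReal (ar + Src t))).add h1).add h2
      rw [add_zero] at h3
      exact h3
    have hlim_M : Tendsto (fun M : ℕ => ENNReal.ofReal (ar + Src t) + ENNReal.ofReal |SrcM M t - Src t|) atTop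
        (𝓝 (ENNReal.ofReal (ar + Src t))) := by
      have h2 : Tendsto (fun M : ℕ => ENNReal.ofReal |SrcM M t - Src t|) atTop (𝓝 0) := by
        have h3 := ((hSrcM_lim t htT).sub_const (Src t)).abs
        rw [sub_self, abs_zero] at h3
        have := ENNReal.tendsto_ofReal h3
        rwa [ENNReal.ofReal_zero] at this
      have h4 := (tendsto_const_nhds (x := ENNReal.ofReal (ar + Src t))).add h2
      rw [add_zero] at h4
      exact h4
    constructor
    · calc ∫⁻ s in Ioo 0 t, ENNReal.ofReal (2 * κ) * eScalarGradNormSq (θ s)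
          ≤ ∫⁻ s, liminf (fun M : ℕ => liminf (fun n => ENNReal.ofReal (2 * κ) *
              eScalarGradNormSq (Calculus.trunc (M : ℝ) ∘ (θ s ⋆ kk n))) atTop) atTop ∂μt := by
            refine lintegral_mono_ae ?_
            filter_upwards [ae_restrict_of_ae_restrict_of_subset hsub hlsc_M,
              ae_restrict_of_ae_restrict_of_subset hsub hlsc_n] with s h1 h2
            exact h1.trans (liminf_le_liminf (Eventually.of_forall h2))
        _ ≤ liminf (fun M : ℕ => ∫⁻ s, liminf (fun n => ENNReal.ofReal (2 * κ) *
              eScalarGradNormSq (Calculus.trunc (M : ℝ) ∘ (θ s ⋆ kk n))) atTop ∂μt) atTop :=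
            lintegral_liminf_le' fun M => aemeasurable_liminf_nat fun n => (hem M n).mono_measure hle
        _ ≤ liminf (fun M : ℕ => liminf (fun n => ∫⁻ s, ENNReal.ofReal (2 * κ) *
              eScalarGradNormSq (Calculus.trunc (M : ℝ) ∘ (θ s ⋆ kk n)) ∂μt) atTop) atTop :=
            liminf_le_liminf (Eventually.of_forall fun M => lintegral_liminf_le' fun n => (hem M n).mono_measure hle)
        _ ≤ liminf (fun M : ℕ => liminf (fun n => ENNReal.ofReal (ar + Src t) +
              ENNReal.ofReal (Cβ M) * (∫⁻ s, ρ n s ∂μT) + ENNReal.ofReal (e M n)) atTop) atTop :=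
            liminf_le_liminf (Eventually.of_forall fun M => liminf_le_liminf (Eventually.of_forall fun n => ht_bound M n))
        _ = liminf (fun M : ℕ => ENNReal.ofReal (ar + Src t) + ENNReal.ofReal |SrcM M t - Src t|) atTop := by
            refine liminf_congr (Eventually.of_forall fun M => ?_)
            exact (hlim_n M).liminf_eq
        _ = ENNReal.ofReal (ar + Src t) := hlim_M.liminf_eq
    · have hR1 : ∀ (M n : ℕ), 0 ≤ ar + Cβ M * (∫⁻ s, ρ n s ∂μT).toReal + SrcMn M n t := fun M n =>
        le_trans (mul_nonneg hκ.le (setIntegral_nonneg measurableSet_Ioc fun s _ => hD0 M n s)) (hct M n)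
      have hR2 : ∀ M : ℕ, 0 ≤ ar + SrcM M t := by
        intro M
        have h0 : Tendsto (fun n => (∫⁻ s, ρ n s ∂μT).toReal) atTop (𝓝 0) := by
          have h5 := (ENNReal.tendsto_toReal ENNReal.zero_ne_top).comp hP0
          rw [ENNReal.toReal_zero] at h5
          exact h5
        have hl : Tendsto (fun n => ar + Cβ M * (∫⁻ s, ρ n s ∂μT).toReal + SrcMn M n t) atTop
            (𝓝 (ar + Cβ M * 0 + SrcM M t)) :=
          ((tendsto_const_nhds (x := ar)).add ((tendsto_const_nhds (x := Cβ M)).mul h0)).add (hSrcMn_lim M t htT)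
        rw [mul_zero, add_zero] at hl
        exact ge_of_tendsto' hl fun n => hR1 M n
      exact ge_of_tendsto' ((tendsto_const_nhds (x := ar)).add (hSrcM_lim t htT)) hR2
  -- ### from a.e. `t` to `T`
  have hSrc_cont : ContinuousOn (fun t => ar + Src t) (Icc 0 T) := by
    have hgi' : IntegrableOn g (Icc 0 T) volume := IntegrableOn.congr_set_ae hgi Ioo_ae_eq_Icc.symm
    have hc := intervalIntegral.continuousOn_primitive hgi'
    exact continuousOn_const.add (continuousOn_const.mul hc)
  have hfin : ∫⁻ s in Ioo 0 T, ENNReal.ofReal (2 * κ) * eScalarGradNormSq (θ s) ≤ ENNReal.ofReal (ar + Src T) :=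
    setLIntegral_Ioo_le_ofReal_of_ae hT hSrc_cont (hmain.mono fun t ht => ht.1)
  have hrealT : 0 ≤ ar + Src T := by
    obtain ⟨t, -, ht, htT⟩ := exists_monotone_tendsto_of_ae hT (hmain.mono fun t ht => ht.2)
    have hc := (hSrc_cont T (right_mem_Icc.2 hT.le)).tendsto.comp
      (tendsto_nhdsWithin_of_tendsto_nhds_of_eventually_within t htT
        (Eventually.of_forall fun n => Ioo_subset_Icc_self (ht n).1))
    exact ge_of_tendsto' hc fun n => (ht n).2
  -- ### conclusion
  have hSrcT : Src T = 2 * ∫ t in Ioo 0 T, ∫ x, θ t x * f x := by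
    simp only [hSrc_def, hg_def]
    rw [integral_Ioc_eq_integral_Ioo]
  refine ⟨?_, by rw [← hSrcT]; exact hrealT⟩
  calc 2 * eScalarDissipation κ θ 0 T
      = ∫⁻ s, ENNReal.ofReal (2 * κ) * eScalarGradNormSq (θ s) ∂μT := by
        rw [eScalarDissipation, ← mul_assoc, h2κ, hμT, lintegral_const_mul' _ _ ENNReal.ofReal_ne_top]
    _ ≤ ENNReal.ofReal (ar + Src T) := hfin
    _ = _ := by rw [hSrcT]


end IsWeakScalarTransportForcedOn

end Torus

end Literature.Analysis.FluidPDE
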